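import Mathlib.Data.List.FinRange
import Literature.IUT.HodgeTheaters.PuncturedEllipticCoveringsCusps
import Literature.IUT.HodgeTheaters.PuncturedEllipticCoveringsCuspRecovery
import HarnessLib

/-!
# [IUTchI] Cor. 1.2, proof p. 39: the zero cusp is ramified in `X̲→ → X̲` — from the oriented surface relation (proof-only)

Mochizuki, *Inter-universal Teichmüller theory I*, kurims manuscript (May 2020), §1, proof of
Corollary 1.2 p. 39: «The conjugacy classes of the decomposition groups of `ε⁰, ε′, ε″` in `Π_X̲` may be
recovered as the decomposition groups of cusps … whose image in `Gal(X̲→/X̲) = Π_X̲/Π_{X̲→}` is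
nontrivial» ([IUTchI] Cor 1.2 p.39) [claim: Mochizuki2012, status: disputed] (D-0012 claim key;
series status DISPUTED — proof-only companion over abc-iut-L5-t1's frozen `PuncturedEllipticCoverings.lean`
and `…Cusps.lean`; nothing is restated, no definition, no side is taken on [IUTchIII] Cor. 3.12).

WHAT THIS FILE DOES (GAP-LEDGER G-L5d4g6-1, the positive half of the «t1 reading»).  The clause for
`ε⁰` — `¬ I_{ε⁰} ⊆ Π_{X̲→}`, the binder `h0` of abc-iut-L5-d4's
`characteristicNatureOfCoverings_of_anabelian` — is NOT a consequence of the typed §1 record (kernel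
certificate: `ArrowModel.inertia_ε0_clause_independent`, `PuncturedEllipticArrowModelUnorientedDatum.lean`).
Here it is DERIVED from the typed claims of p. 38 (`ArrowCoveringClaims`), the openness clause
(`ArrowOpenClaims`) and hypotheses of exactly the shape of the standard structure of the geometric
fundamental group of a curve of type `(1, l)` — the input print uses tacitly (p. 37: «natural exact
sequence `1 → I_{ε′} × I_{ε″} → Δ_ε → Δ_E ⊗ ℤ/l → 1`», i.e. the inertia groups of the `l` cusps of `X̲`
satisfy ONE relation in `Δ_X̲^{ab}`):
* (gen/or) ORIENTED topological generators `z_x ∈ I_x` of the cusp inertia groups (`I_x ≅ Ẑ(1)`; only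
  `I_{ε′} ⊆ closure ⟨z_{ε′}⟩` is used);
* (rel) the SURFACE RELATION: in the order of a presentation `e : Fin n ≃ Cusp(X̲)`, the product
  `∏_i z_{e(i)}` lies in the closed commutator subgroup of `Δ_X̲` (`Π_{1,r} = ⟨α, β, γ_1, …, γ_r |
  [α, β]·γ_1⋯γ_r = 1⟩^∧`);
* (inv) the involution `ι̲ ∈ Gal(X̲/C̲)` (any `c ∈ Π_C̲ ∖ Π_X`, which switches `ε′, ε″`: `CuspGalois.act_ε1`)
  carries the oriented generator of `I_{ε′}` to that of `I_{ε″}` modulo `Ker(Δ_X̲ ↠ Δ_X̲^{ab} ⊗ ℤ/l)`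
  (automorphisms of `X̲` respect the cyclotomic orientation of inertia; well defined mod `l` under (∗)).
ROUTE (`ArrowCoveringClaims.not_inertia_ε0_le_piXarrow_of_orientedInertia`): if `I_{ε⁰} ⊆ Π_{X̲→}` then
every `z_x`, `x ∉ {ε′, ε″}`, dies in `Q := Δ_X̲/jKer` (`jKer = Π_{X̲→} ∩ Δ_C`; the other nonzero cusps die by
construction), so (rel) gives `z_{ε′}·z_{ε″} ∈ jKer` (reordering costs commutators, which lie in `jKer`);
`ι̲` acts trivially on `Q` (`Π_C̲/Π_{X̲→}` is cyclic), so (inv) gives `z_{ε′} ≡ z_{ε″}`, whence `z_{ε′}² ∈ jKer`;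
`[Δ_X̲ : jKer] = l` is odd, so `z_{ε′} ∈ jKer`, `I_{ε′} ⊆ jKer ⊆ Π_{X̲→}` (`jKer` is closed) — contradicting
`I_{ε′} ⥲ Δ_ε⁺` (`ArrowCoveringClaims.not_inertia_ε1_le_piXarrow`, abc-iut-L5-d4).  Two reusable group
lemmas: a permutation of a list of elements of `H` changes the product by an element of any
`N ⊇ [H, H]`; a cyclic quotient `H/N` forces `[H, H] ⊆ N`.  PROOF-ONLY; axioms standard.
-/

namespace Literature.IUT.HodgeTheaters

namespace PuncturedEllipticData

open scoped Pointwise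
open Literature.AnabelianGeometry.AbsoluteAnabelian

universe u

/-! ### Two group-theoretic lemmas -/

/-- Permuting a list of elements of `H` changes its product by an element of any subgroup `N` with
`[H, H] ⊆ N ⊆ H`. [claim: Mochizuki2012, status: disputed] -/
theorem prod_mul_prod_inv_mem_of_perm {G : Type*} [Group G] {H N : Subgroup G} (hN : ⁅H, H⁆ ≤ N)
    (hNH : N ≤ H) {l l' : List G} (hp : l.Perm l') (hl : ∀ g ∈ l, g ∈ H) :
    l.prod * l'.prod⁻¹ ∈ N := by
  induction hp with
  | nil => simp [N.one_mem]
  | cons a _ ih =>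
    have ha : a ∈ H := hl a List.mem_cons_self
    have ih' := ih fun g hg => hl g (List.mem_cons_of_mem a hg)
    have hc := Subgroup.commutator_mem_commutator ha (hNH ih')
    rw [commutatorElement_def] at hc
    rw [List.prod_cons, List.prod_cons]
    -- `a x (a y)⁻¹ = (a (x y⁻¹) a⁻¹ (x y⁻¹)⁻¹) · (x y⁻¹)`
    have e : ∀ x y : G, a * x * (a * y)⁻¹ =
        a * (x * y⁻¹) * a⁻¹ * (x * y⁻¹)⁻¹ * (x * y⁻¹) := fun x y => by group
    rw [e]
    exact N.mul_mem (hN hc) ih'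
  | swap a b l =>
    have ha : a ∈ H := hl a (List.mem_cons_of_mem b List.mem_cons_self)
    have hb : b ∈ H := hl b List.mem_cons_self
    have hc := Subgroup.commutator_mem_commutator hb ha
    rw [commutatorElement_def] at hc
    rw [List.prod_cons, List.prod_cons, List.prod_cons, List.prod_cons]
    have e : b * (a * l.prod) * (a * (b * l.prod))⁻¹ = b * a * b⁻¹ * a⁻¹ := by group
    rw [e]
    exact hN hc
  | trans h₁ _ ih₁ ih₂ =>
    have h1 := ih₁ hl
    have h2 := ih₂ fun g hg => hl g (h₁.mem_iff.mpr hg)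
    have e : ∀ x y w : G, x * w⁻¹ = x * y⁻¹ * (y * w⁻¹) := fun x y w => by group
    rw [e]
    exact N.mul_mem h1 h2

/-- If `H/N` is cyclic then `H`-commutators lie in `N`. [claim: Mochizuki2012, status: disputed] -/
theorem commutator_mem_of_isCyclic_quotient {G : Type*} [Group G] {H N : Subgroup G}
    [(N.subgroupOf H).Normal] (hc : IsCyclic (H ⧸ N.subgroupOf H)) {a b : G} (ha : a ∈ H)
    (hb : b ∈ H) : a * b * a⁻¹ * b⁻¹ ∈ N := by
  obtain ⟨g, hg⟩ := exists_zpow_surjective (H ⧸ N.subgroupOf H)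
  obtain ⟨m, hm⟩ := hg ((⟨a, ha⟩ : H) : H ⧸ N.subgroupOf H)
  obtain ⟨k, hk⟩ := hg ((⟨b, hb⟩ : H) : H ⧸ N.subgroupOf H)
  simp only at hm hk
  have hab : ((⟨a, ha⟩ : H) : H ⧸ N.subgroupOf H) * ((⟨b, hb⟩ : H) : H ⧸ N.subgroupOf H) =
      ((⟨b, hb⟩ : H) : H ⧸ N.subgroupOf H) * ((⟨a, ha⟩ : H) : H ⧸ N.subgroupOf H) := by
    rw [← hm, ← hk]
    exact (Commute.zpow_zpow (Commute.refl g) m k).eq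
  have h1 : (((⟨a, ha⟩ : H) * ⟨b, hb⟩ * (⟨a, ha⟩ : H)⁻¹ * (⟨b, hb⟩ : H)⁻¹ : H) : H ⧸ N.subgroupOf H) = 1 := by
    rw [QuotientGroup.mk_mul, QuotientGroup.mk_mul, QuotientGroup.mk_mul, QuotientGroup.mk_inv,
      QuotientGroup.mk_inv, hab, mul_inv_cancel_right, mul_inv_cancel]
  rw [QuotientGroup.eq_one_iff, Subgroup.mem_subgroupOf] at h1
  exact h1

variable {D : PuncturedEllipticData.{u}}

/-! ### Facts about `jKer` under the printed claims -/

/-- Conjugation by `Π_C̲` preserves `jKer` (`jKer ⊴ Π_C̲`, `ArrowCoveringClaims.jKer_normal`).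
([IUTchI] §1 p.38) [claim: Mochizuki2012, status: disputed] -/
theorem ArrowCoveringClaims.conj_mem_jKer (h : D.ArrowCoveringClaims) {g n : D.PiC} (hg : g ∈ D.PiCbar)
    (hn : n ∈ D.jKer) : g * n * g⁻¹ ∈ D.jKer := by
  have hnC : n ∈ D.PiCbar := D.deltaCbar_le_piCbar (D.deltaXbar_le_deltaCbar (D.jKer_le_deltaXbar hn))
  have h' := h.jKer_normal.conj_mem ⟨n, hnC⟩ (Subgroup.mem_subgroupOf.mpr hn) ⟨g, hg⟩
  exact Subgroup.mem_subgroupOf.mp h'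

/-- `[Δ_X̲, Δ_X̲] ⊆ jKer` (`jKer ⊇ Ker(Δ_X̲ ↠ Δ_X̲^{ab} ⊗ ℤ/l)`). ([IUTchI] §1 p.38) [claim: Mochizuki2012, status: disputed] -/
theorem commutator_deltaXbar_le_jKer : ⁅D.DeltaXbar, D.DeltaXbar⁆ ≤ D.jKer :=
  le_trans (le_trans le_sup_left (Subgroup.le_topologicalClosure _))
    (le_sup_left.trans (le_sup_left : D.deltaEpsKer ≤ D.jKer))

/-- The closed commutator subgroup of `Δ_X̲` lies in `Ker(Δ_X̲ ↠ Δ_X̲^{ab} ⊗ ℤ/l) ⊆ jKer`.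
([IUTchI] §1 p.37) [claim: Mochizuki2012, status: disputed] -/
theorem closure_commutator_deltaXbar_le_jKer :
    (⁅D.DeltaXbar, D.DeltaXbar⁆).topologicalClosure ≤ D.jKer :=
  (Subgroup.topologicalClosure_mono le_sup_left).trans
    (le_sup_left.trans (le_sup_left : D.deltaEpsKer ≤ D.jKer))

/-- Under the printed claims, `ι̲` — indeed all of `Π_C̲` — acts trivially on `Δ_X̲/jKer`: for `g ∈ Π_C̲`
and `x ∈ Δ_X̲`, `g x g⁻¹ x⁻¹ ∈ jKer` (`Π_C̲/Π_{X̲→}` is cyclic and `jKer = Π_{X̲→} ∩ Δ_C`).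
([IUTchI] §1 p.38) [claim: Mochizuki2012, status: disputed] -/
theorem ArrowCoveringClaims.conj_mul_inv_mem_jKer (h : D.ArrowCoveringClaims) {g x : D.PiC}
    (hg : g ∈ D.PiCbar) (hx : x ∈ D.DeltaXbar) : g * x * g⁻¹ * x⁻¹ ∈ D.jKer := by
  haveI := h.piXarrow_normal
  have h1 : g * x * g⁻¹ * x⁻¹ ∈ D.piXarrow :=
    commutator_mem_of_isCyclic_quotient h.galX_cyclic hg
      (D.piXbar_le_piCbar (D.deltaXbar_le_piXbar hx))
  have h2 : g * x * g⁻¹ * x⁻¹ ∈ D.DeltaC :=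
    D.DeltaC.mul_mem (D.E.normal_geom.conj_mem x hx.2 g) (D.DeltaC.inv_mem hx.2)
  rw [← h.piXarrow_inf_delta]
  exact ⟨h1, h2⟩

/-- Under the printed claims and the openness clause, `jKer = Π_{X̲→} ∩ Δ_C` is closed.
([IUTchI] §1 p.38) [claim: Mochizuki2012, status: disputed] -/
theorem ArrowCoveringClaims.isClosed_jKer (h : D.ArrowCoveringClaims) (hO : D.ArrowOpenClaims) :
    IsClosed (D.jKer : Set D.PiC) := by
  rw [← h.piXarrow_inf_delta, Subgroup.coe_inf]
  exact (D.piXarrow.isClosed_of_isOpen hO.isOpen_piXarrow).inter D.E.isClosed_geom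

/-- Under the printed claims, `x^l ∈ jKer` for every `x ∈ Δ_X̲` (`[Δ_X̲ : jKer] = l`, `jKer ⊴ Δ_X̲`).
([IUTchI] §1 p.38) [claim: Mochizuki2012, status: disputed] -/
theorem ArrowCoveringClaims.pow_l_mem_jKer (h : D.ArrowCoveringClaims) {x : D.PiC} (hx : x ∈ D.DeltaXbar) :
    x ^ D.l ∈ D.jKer := by
  haveI : (D.jKer.subgroupOf D.DeltaXbar).Normal := by
    refine ⟨fun n hn g => ?_⟩
    rw [Subgroup.mem_subgroupOf] at hn ⊢
    have hc := Subgroup.commutator_mem_commutator g.2 n.2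
    rw [commutatorElement_def] at hc
    have e : ((g * n * g⁻¹ : D.DeltaXbar) : D.PiC) = (g : D.PiC) * n * (g : D.PiC)⁻¹ * (n : D.PiC)⁻¹ * n := by
      push_cast; group
    rw [e]
    exact D.jKer.mul_mem (commutator_deltaXbar_le_jKer hc) hn
  have hmem := (D.jKer.subgroupOf D.DeltaXbar).pow_index_mem ⟨x, hx⟩
  rw [Subgroup.mem_subgroupOf, Subgroup.coe_pow] at hmem
  have hidx : (D.jKer.subgroupOf D.DeltaXbar).index = D.l := h.jKer_relindex
  rwa [hidx] at hmem

/-! ### The zero cusp is ramified -/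

/-- **[IUTchI] Cor. 1.2, proof p. 39 — the clause for `ε⁰`, DERIVED:** under the printed claims of p. 38
(`ArrowCoveringClaims`) and the openness clause, the inertia group of the zero cusp `ε⁰` is NOT contained in
`Π_{X̲→}` [its image in `Gal(X̲→/X̲)` is nontrivial], GIVEN oriented topological generators `z_x ∈ I_x`
of the cusp inertia groups (gen: `I_{ε′} ⊆ closure ⟨z_{ε′}⟩`) satisfying the SURFACE RELATION (rel:
`∏_i z_{e(i)}` lies in the closed commutator subgroup of `Δ_X̲` for a presentation order
`e : Fin n ≃ Cusp(X̲)`) and carried to each other by the involution (inv: some `c ∈ Π_C̲ ∖ Π_X` satisfies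
`(tc) z_{ε′} (tc)⁻¹ ≡ z_{ε″}` modulo `Ker(Δ_X̲ ↠ Δ_X̲^{ab} ⊗ ℤ/l)` for some `t ∈ Π_X̲`).  These three inputs
are étale-π₁-of-curves structure (INTERFACE, TODO-merge abc-iut-L4-t1), not [IUTchI] claims; with them the
binder `h0` of `characteristicNatureOfCoverings_of_anabelian` is discharged.
([IUTchI] Cor 1.2 p.39) [claim: Mochizuki2012, status: disputed] -/
theorem ArrowCoveringClaims.not_inertia_ε0_le_piXarrow_of_orientedInertia (h : D.ArrowCoveringClaims)
    (hO : D.ArrowOpenClaims) (z : D.Cusp → D.PiC) (hz : ∀ x, z x ∈ D.inertia x)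
    (hgen : D.inertia D.ε1 ≤ (Subgroup.zpowers (z D.ε1)).topologicalClosure)
    (hrel : ∃ (n : ℕ) (e : Fin n ≃ D.Cusp),
      (List.ofFn fun i => z (e i)).prod ∈ (⁅D.DeltaXbar, D.DeltaXbar⁆).topologicalClosure)
    (hinv : ∃ c ∈ D.PiCbar, c ∉ D.PiX ∧ ∃ t ∈ D.PiXbar,
      (t * c) * z D.ε1 * (t * c)⁻¹ * (z D.ε2)⁻¹ ∈ D.modLKer) :
    ¬ D.inertia D.ε0 ≤ D.piXarrow := by
  intro hle
  -- every `z_x` lies in `Δ_X̲`; for `x ∉ {ε′, ε″}` it lies in `jKer = Π_{X̲→} ∩ Δ_C`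
  have hzΔ : ∀ x, z x ∈ D.DeltaXbar := fun x => D.inertia_le_deltaXbar x (hz x)
  have hzj : ∀ x, x ≠ D.ε1 → x ≠ D.ε2 → z x ∈ D.jKer := by
    intro x h1 h2
    rw [← h.piXarrow_inf_delta]
    refine ⟨?_, (inf_le_right : D.inertia x ≤ D.DeltaC) (hz x)⟩
    by_cases h0 : x = D.ε0
    · subst h0; exact hle (hz _)
    · exact D.inertia_le_piXarrow_of_ne h0 h1 h2 (hz x)
  set z1 := z D.ε1 with hz1
  set z2 := z D.ε2 with hz2
  -- (S1) the surface relation gives `z_{ε′} z_{ε″} ∈ jKer`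
  have hS1 : z1 * z2 ∈ D.jKer := by
    obtain ⟨n, e, hP⟩ := hrel
    have hPj : (List.ofFn fun i => z (e i)).prod ∈ D.jKer := closure_commutator_deltaXbar_le_jKer hP
    -- indices of `ε′, ε″`; `n ≥ 2`
    set i₁ := e.symm D.ε1 with hi₁
    set i₂ := e.symm D.ε2 with hi₂
    have hne : i₁ ≠ i₂ := fun heq => D.ε1_ne_ε2 (e.symm.injective heq)
    obtain ⟨m, rfl⟩ : ∃ m, n = m + 2 :=
      ⟨n - 2, by
        have h1 := i₁.isLt
        have h2 := i₂.isLt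
        have h3 : (i₁ : ℕ) ≠ i₂ := fun heq => hne (Fin.ext heq)
        omega⟩
    -- a permutation `σ` of `Fin (m+2)` with `σ 0 = i₁`, `σ 1 = i₂`
    set τ : Equiv.Perm (Fin (m + 2)) := Equiv.swap 0 i₁ with hτ
    set j := τ.symm i₂ with hj
    have hj0 : j ≠ 0 := by
      intro hj0'
      have : τ 0 = i₂ := by rw [← hj0', hj, Equiv.apply_symm_apply]
      rw [hτ, Equiv.swap_apply_left] at this
      exact hne this
    set σ : Equiv.Perm (Fin (m + 2)) := τ * Equiv.swap 1 j with hσ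
    have hσ0 : σ 0 = i₁ := by
      rw [hσ, Equiv.Perm.mul_apply, Equiv.swap_apply_of_ne_of_ne Fin.zero_ne_one hj0.symm, hτ,
        Equiv.swap_apply_left]
    have hσ1 : σ 1 = i₂ := by
      rw [hσ, Equiv.Perm.mul_apply, Equiv.swap_apply_left, hj, Equiv.apply_symm_apply]
    -- the permuted list `z_{ε′} :: z_{ε″} :: rest` has product `≡ P` modulo `jKer`
    have hperm : (List.ofFn ((fun i => z (e i)) ∘ σ)).Perm (List.ofFn fun i => z (e i)) :=
      Equiv.Perm.ofFn_comp_perm σ _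
    have hmem := prod_mul_prod_inv_mem_of_perm (H := D.DeltaXbar) (N := D.jKer) commutator_deltaXbar_le_jKer
      D.jKer_le_deltaXbar hperm (fun g hg => by
        rw [List.mem_ofFn] at hg
        obtain ⟨i, rfl⟩ := hg
        exact hzΔ _)
    have hP' : (List.ofFn ((fun i => z (e i)) ∘ σ)).prod ∈ D.jKer := by
      have e1 : (List.ofFn ((fun i => z (e i)) ∘ σ)).prod =
          (List.ofFn ((fun i => z (e i)) ∘ σ)).prod * (List.ofFn fun i => z (e i)).prod⁻¹ *
            (List.ofFn fun i => z (e i)).prod := by rw [inv_mul_cancel_right]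
      rw [e1]
      exact D.jKer.mul_mem hmem hPj
    -- split off the first two factors
    rw [List.ofFn_succ, List.ofFn_succ, List.prod_cons, List.prod_cons] at hP'
    simp only [Function.comp_apply] at hP'
    rw [hσ0, hi₁, Equiv.apply_symm_apply] at hP'
    have e2 : σ (Fin.succ 0) = i₂ := by rw [Fin.succ_zero_eq_one]; exact hσ1
    rw [e2, hi₂, Equiv.apply_symm_apply] at hP'
    -- the remaining factors lie in `jKer`
    have hrest : (List.ofFn fun i : Fin m => z (e (σ i.succ.succ))).prod ∈ D.jKer := by
      refine Subgroup.list_prod_mem _ fun g hg => ?_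
      rw [List.mem_ofFn] at hg
      obtain ⟨i, rfl⟩ := hg
      refine hzj _ (fun h1 => ?_) (fun h2 => ?_)
      · have : σ i.succ.succ = σ 0 := by rw [hσ0, hi₁, ← h1, Equiv.symm_apply_apply]
        exact absurd (σ.injective this) (Fin.succ_ne_zero _)
      · have : σ i.succ.succ = σ 1 := by rw [hσ1, hi₂, ← h2, Equiv.symm_apply_apply]
        have h' := σ.injective this
        rw [← Fin.succ_zero_eq_one, Fin.succ_inj] at h'
        exact Fin.succ_ne_zero _ h'
    have e3 : z1 * z2 = z1 * (z2 * (List.ofFn fun i : Fin m => z (e (σ i.succ.succ))).prod) *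
        ((List.ofFn fun i : Fin m => z (e (σ i.succ.succ))).prod)⁻¹ := by
      rw [← mul_assoc, mul_inv_cancel_right]
    rw [e3]
    exact D.jKer.mul_mem hP' (D.jKer.inv_mem hrest)
  -- (S2)+(S3): `z_{ε″} ≡ ι̲ z_{ε′} ι̲⁻¹ ≡ z_{ε′}` modulo `jKer`, so `z_{ε′} z_{ε″}⁻¹ ∈ jKer`
  have hS23 : z1 * z2⁻¹ ∈ D.jKer := by
    obtain ⟨c, hc, -, t, ht, hv⟩ := hinv
    have htc : t * c ∈ D.PiCbar := D.PiCbar.mul_mem (D.piXbar_le_piCbar ht) hc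
    have hu : (t * c) * z1 * (t * c)⁻¹ * z1⁻¹ ∈ D.jKer := h.conj_mul_inv_mem_jKer htc (hzΔ _)
    have hv' : (t * c) * z1 * (t * c)⁻¹ * z2⁻¹ ∈ D.jKer :=
      ((le_sup_left : D.modLKer ≤ D.deltaEpsKer).trans (le_sup_left : D.deltaEpsKer ≤ D.jKer)) hv
    have e : z1 * z2⁻¹ = ((t * c) * z1 * (t * c)⁻¹ * z1⁻¹)⁻¹ * ((t * c) * z1 * (t * c)⁻¹ * z2⁻¹) := by
      group
    rw [e]
    exact D.jKer.mul_mem (D.jKer.inv_mem hu) hv'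
  -- (S4) hence `z_{ε′}² ∈ jKer`
  have hS4 : z1 * z1 ∈ D.jKer := by
    have h' : z1⁻¹ * (z1 * z2) * z1⁻¹⁻¹ ∈ D.jKer :=
      h.conj_mem_jKer (D.PiCbar.inv_mem (D.piXbar_le_piCbar (D.deltaXbar_le_piXbar (hzΔ _)))) hS1
    have e : z1 * z1 = z1 * z2⁻¹ * (z1⁻¹ * (z1 * z2) * z1⁻¹⁻¹) := by group
    rw [e]
    exact D.jKer.mul_mem hS23 h'
  -- (S5) `l` is odd and `z_{ε′}^l ∈ jKer`, so `z_{ε′} ∈ jKer`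
  have hS5 : z1 ∈ D.jKer := by
    have hodd : Odd D.l :=
      Nat.coprime_two_right.mp (Nat.Coprime.coprime_dvd_right (show 2 ∣ 6 by norm_num) D.coprime_six)
    obtain ⟨q, hq⟩ := hodd
    have hl : z1 ^ D.l ∈ D.jKer := h.pow_l_mem_jKer (hzΔ _)
    rw [hq, pow_succ, pow_mul, pow_two] at hl
    have e : z1 = ((z1 * z1) ^ q)⁻¹ * ((z1 * z1) ^ q * z1) := by rw [inv_mul_cancel_left]
    rw [e]
    exact D.jKer.mul_mem (D.jKer.inv_mem (D.jKer.pow_mem hS4 q)) hl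
  -- (S6) `I_{ε′} ⊆ closure ⟨z_{ε′}⟩ ⊆ jKer ⊆ Π_{X̲→}`, contradiction
  have hS6 : D.inertia D.ε1 ≤ D.jKer :=
    hgen.trans (Subgroup.topologicalClosure_minimal _
      ((Subgroup.zpowers_le (G := D.PiC)).mpr hS5) (h.isClosed_jKer hO))
  exact h.not_inertia_ε1_le_piXarrow (hS6.trans (le_sup_right : D.jKer ≤ D.piXarrow))

end PuncturedEllipticData

end Literature.IUT.HodgeTheaters
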